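/-
Copyright: cell pub-balaban-gaps (YM BLITZ Y1, track G1), seat g1-p2 GEN 5 (unit `pub-balaban-gaps-g1-p2`).  Row (D4) NODE O,
OBJECT ∕ MECHANISM level: [B9] THEOREM 3.10 AT ONE SCALE IN BLOCK CURRENCY WITH PRINT'S POWER-ONE s-DECORATION ([II] p. 3) —
the glued inverse `G′ = S(1 − R)⁻¹ = Σ_ω G′_ω` of domain-localised seed ∕ step families, run σ-FREE-PRICED (tags at polydisc
radius `1`), then decorated ONCE per distinct parameter met, `H(s) = Σ_ω (Π_{Δ ∈ dec ω} s(Δ))·G′_ω`, the (1.11) cost paid by the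
RATE SHIFT `κ₁P∕r₀` inside the window (`D4WalkBlockDecorate`) under the chains' TUBE letter (`D4WalkBlockDecorateChains`):
print's regime *"δ₁M ≥ κ₁"* — M LINEAR in κ₁ — replacing the cell's per-step `e^{κ₁m_J}` (RESIDUE (D4) V47 ∕ V54).
HONEST FRAMING: mechanism over hypothesis letters (`IsDomainLocalB` seed ∕ step data, packing, parameter attachment); nothing of
Bałaban's constructed; (D4) NOT discharged (instance 0∕1); NOT BetaPertH, NOT continuum, NOT Clay.
-/
import Summits.QuantumFields.BalabanUV.Gaps.D4WalkBlockDecorateChains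
import Summits.QuantumFields.BalabanUV.Gaps.D4WalkBlockOneScale
import Summits.QuantumFields.BalabanUV.T4Continuum.Spine.NE5.TwoRunPencilDomains

/-!
# `Gaps.D4WalkBlockOneScaleDecorated` — Thm 3.10 at one scale, block currency, print's power-one decoration with rate shift
(cell pub-balaban-gaps, seat g1-p2 gen 5)

HONEST DEPENDENCY (cell pub-balaban, verbatim): continuum YM on T⁴ ⇐ BetaPertH ∧ nine spine estimates (0/9 proved);
BetaPertH ⇐ (D1) ∧ (D4) ∧ CAP+tail.

`blockWalkExpansion_oneScale_decorated`: the data of `D4WalkBlockOneScale.blockWalkExpansion_oneScale` (two block-local families on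
ONE skeleton `L`, letters `(R, λ_S ∕ λ_R, r, m_J, n_D)` at the TAG consts `c₀` — take `κ₁(c₀) = 0` so `e^{κ₁(c₀)m_J} = 1` — cube row
sum, rates, margin) PLUS the decoration data (`cellOf : cubes → parameters`, the TRUE parameter sets `J′ b ⊆ (dom b).image cellOf`
with `J′ b ≠ ∅ → J b ≠ ∅`, packing `P` at radius `R_b ≥ r₀ + r`, `0 < r₀`) and the shift condition `κ₁·(P∕r₀) ≤ ε₀ − 3μ` ⟹ the
EXPLICIT glued family (`mul ∘ inv_pencil ∘ one`, GEN 4's `blockWalkExpansion_glue` with its witnesses kept) decorated by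
`dec ω = J′(seed) ∪ ⋃ J′(steps)` is a `BlockWalkExpansion` at the physical consts `c`: window `ε₀ − 3μ − κ₁P∕r₀`, rate
`ρ₀ − 3μ − κ₁P∕r₀`, torus rate `κ₀ − 2μ`, constants `× e^{κ₁P}`; and its kernel at `σ ≡ 1` is `S(1,u)(1 − R(1,u))⁻¹` (for the
parametrix = `Δ′(u)⁻¹`, `D4WalkBlockParametrix.glued_one_eq_inv`).
WHAT IT IS NOT: nothing of Bałaban's; the (v)⁺ repackaging with the decorated Γ-slot is routine and left to the consumer; (D4)
instance 0∕1; words UNCHANGED.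
-/

noncomputable section

namespace Summit.QuantumFields.BalabanUV.Gaps.D4WalkBlockOneScaleDecorated

open Metric Set Finset
open Literature.MathematicalPhysics.QuantumFieldTheory.Balaban1983to89
open Literature.MathematicalPhysics.QuantumFieldTheory.Balaban1983to89.B9SectDWalk (Through MajSumLe DomBy infConv chainDist)
open Literature.MathematicalPhysics.QuantumFieldTheory.Balaban1983to89.B9Thm34Ext (toB6)
open Literature.MathematicalPhysics.QuantumFieldTheory.Balaban1983to89.B9Thm37GlueTorus (torusGeom tdist1 tdist1_nonneg)
open Literature.MathematicalPhysics.QuantumFieldTheory.Balaban1983to89.TreeLengthTorus (TPt)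
open Literature.MathematicalPhysics.QuantumFieldTheory.Balaban1983to89.B5TorusCover (UT)
open Literature.MathematicalPhysics.QuantumFieldTheory.Balaban1983to89.B11SectG (RowSum)
open Literature.MathematicalPhysics.QuantumFieldTheory.Balaban1983to89.B13DomainKernelWalks (DomainTerms)
open Summit.QuantumFields.BalabanUV.Gaps.D4WalkBlock (blockNorm BlockWalkExpansion)
open Summit.QuantumFields.BalabanUV.Gaps.D4WalkProduct (domBy_infConv_torus)
open Summit.QuantumFields.BalabanUV.Gaps.D4WalkNeumann (domBy_chain)
open Summit.QuantumFields.BalabanUV.Gaps.D4WalkBlockProduct (blockWalkExpansion_mul)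
open Summit.QuantumFields.BalabanUV.Gaps.D4WalkBlockNeumann (blockWalkExpansion_inv_pencil)
open Summit.QuantumFields.BalabanUV.Gaps.D4WalkBlockGlue (blockWalkExpansion_one)
open Summit.QuantumFields.BalabanUV.Gaps.D4WalkBlockLocal (IsDomainLocalB blockWalkExpansion_domainLocal)
open Summit.QuantumFields.BalabanUV.Gaps.D4WalkBlockDecorate (decTerm decKernel blockWalkExpansion_decorate kernel_decorate_one)
open Summit.QuantumFields.BalabanUV.Gaps.D4WalkBlockDecorateChains (Dch card_params_le)
open Summit.QuantumFields.BalabanUV.T4Continuum.Spine.NE5.TwoRunPencilDomains (withOp)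

variable {ν : ℕ} {K : Fin ν → ℕ} [∀ i, NeZero (K i)]
variable {d N' : ℕ} {n : Type} [Fintype n] [DecidableEq n]
variable {E : Type*} [NormedAddCommGroup E] [NormedSpace ℂ E]
variable {c₀ c : B13.Consts} {cubn : n → UT K} {X : Finset (UT K)}
variable {L : DomainTerms d N' ν K n n E} {opS opR : L.B → E → Matrix n n ℂ}
variable {R lamS lamR r : ℝ} {mJ nD : ℕ} {ρ₀ ε₀ κ₀ μ cμ : ℝ}

/-- The DECORATION of a glued term `(b₀, (l, ()))`: the true parameters of the seed and of every step ([II] p. 3: *"all cubes from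
σ₀ which intersect this localization domain"*). -/
def decG (J' : L.B → Finset (TPt d N')) (ω : L.B × (List (Unit × L.B) × Unit)) : Finset (TPt d N') :=
  J' ω.1 ∪ ω.2.1.foldr (fun i acc => J' i.2 ∪ acc) ∅

omit [Fintype n] [DecidableEq n] in
/-- Membership in the folded union of the steps' parameter sets. [folklore] -/
theorem mem_foldr_union (J' : L.B → Finset (TPt d N')) {δ : TPt d N'} :
    ∀ l : List (Unit × L.B), δ ∈ l.foldr (fun i acc => J' i.2 ∪ acc) ∅ → ∃ i ∈ l, δ ∈ J' i.2
  | [], h => by simp at h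
  | i :: l, h => by
      simp only [List.foldr_cons, Finset.mem_union] at h
      rcases h with hi | hrest
      · exact ⟨i, List.mem_cons_self, hi⟩
      · obtain ⟨i', hi', hδ⟩ := mem_foldr_union J' l hrest
        exact ⟨i', List.mem_cons_of_mem _ hi', hδ⟩

omit [Fintype n] [DecidableEq n] in
/-- Membership in the decoration: a parameter of the seed or of some step. [folklore] -/
theorem mem_decG (J' : L.B → Finset (TPt d N')) (b₀ : L.B) (l : List (Unit × L.B)) (u : Unit)
    {δ : TPt d N'} (h : δ ∈ decG J' (b₀, (l, u))) : δ ∈ J' b₀ ∨ ∃ i ∈ l, δ ∈ J' i.2 := by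
  rcases Finset.mem_union.1 h with h0 | hl
  · exact Or.inl h0
  · exact Or.inr (mem_foldr_union J' l hl)

omit [Fintype n] [DecidableEq n] in
/-- A non-empty decoration has a non-empty parameter set at the seed or at some step. [folklore] -/
theorem decG_nonempty (J' : L.B → Finset (TPt d N')) (ω : L.B × (List (Unit × L.B) × Unit))
    (h : (decG J' ω).Nonempty) : (J' ω.1).Nonempty ∨ ∃ i ∈ ω.2.1, (J' i.2).Nonempty := by
  obtain ⟨δ, hδ⟩ := h
  rcases mem_decG J' ω.1 ω.2.1 ω.2.2 hδ with h0 | ⟨i, hi, hδi⟩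
  · exact Or.inl ⟨δ, h0⟩
  · exact Or.inr ⟨i, hi, δ, hδi⟩

/-- **THEOREM 3.10 AT ONE SCALE, BLOCK CURRENCY, PRINT'S POWER-ONE DECORATION WITH RATE SHIFT.**  See the module docstring.
[cite: Balaban1988RG2Cluster, p.3, (1.11) p.5, p.13, p.15; Balaban1985BackgroundPropagators, Thm 3.7 (3.87)–(3.90) p.409, Cor 3.8 p.410, Thm 3.10 (3.107)–(3.108) p.416; Balaban1984PropagatorsII, (2.61) p.234] -/
theorem blockWalkExpansion_oneScale_decorated
    (hS : IsDomainLocalB (withOp L opS) c₀ cubn cubn X R lamS r mJ nD)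
    (hR : IsDomainLocalB (withOp L opR) c₀ cubn cubn X R lamR r mJ nD)
    (hκ₁₀ : 0 ≤ c₀.κ₁) (hlamS : 0 ≤ lamS) (hlamR : 0 ≤ lamR)
    (hμ : 0 ≤ μ) (hμε : 3 * μ ≤ ε₀) (hμκ : 2 * μ ≤ κ₀) (hwin : κ₀ + μ ≤ ρ₀ - ε₀) (hcμ : 0 ≤ cμ)
    (hrow : RowSum (toB6 (torusGeom K 0 0 0) 0 True) μ cμ)
    (hq : cμ * (cμ * 1 *
      (1 * ((lamR * Real.exp (c₀.κ₁ * mJ) * Real.exp (2 * ρ₀ * r)) * Real.exp (μ * r) * (nD * cμ))) * cμ) * cμ < 1)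
    -- decoration data
    (cellOf : UT K → TPt d N') (J' : L.B → Finset (TPt d N')) (hJ' : ∀ b, J' b ⊆ (L.dom b).image cellOf)
    (hJ'J : ∀ b, (J' b).Nonempty → (L.J b).Nonempty) {P : ℕ} {r₀ Rb : ℝ} (hr₀ : 0 < r₀) (hRD : r₀ + r ≤ Rb)
    (hpack : ∀ a : UT K, ∃ S : Finset (TPt d N'), S.card ≤ P ∧ ∀ z, tdist1 K a z ≤ Rb → cellOf z ∈ S)
    (hκ₁ : 0 ≤ c.κ₁) (hshift : c.κ₁ * (P / r₀) ≤ ε₀ - 3 * μ) :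
    ∃ (W : Type) (T : W → (TPt d N' → ℂ) → E → Matrix n n ℂ) (A : W → ℝ) (D : W → UT K → UT K → ℝ) (ρ' : ℝ)
      (dec : W → Finset (TPt d N')),
      BlockWalkExpansion c cubn cubn (decKernel T dec) X R (ε₀ - 3 * μ - c.κ₁ * (P / r₀)) (κ₀ - 2 * μ)
        (Real.exp (c.κ₁ * P) *
          (cμ * ((lamS * Real.exp (c₀.κ₁ * mJ) * Real.exp (2 * ρ₀ * r)) * Real.exp (μ * r) * (nD * cμ)) *
            (1 * (1 - cμ * (cμ * 1 *
              (1 * ((lamR * Real.exp (c₀.κ₁ * mJ) * Real.exp (2 * ρ₀ * r)) * Real.exp (μ * r) * (nD * cμ))) * cμ) * cμ)⁻¹) * cμ))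
        (decTerm T dec) {w | (dec w).Nonempty} A D ρ' ∧
      (∀ u ∈ ball (0 : E) R, decKernel T dec (fun _ => 1) u =
        (withOp L opS).kernel (fun _ => 1) u *
          ((1 : Matrix n n ℂ) + (-1 : ℂ) • (withOp L opR).kernel (fun _ => 1) u)⁻¹) ∧
      ∀ ω, DomBy (toB6 (torusGeom K 0 0 0) 0 True) (D ω) := by
  have hκ₀ : 0 ≤ κ₀ := by linarith
  have hρ₀ : 0 ≤ ρ₀ := by linarith
  -- the two domain-local BLOCK expansions at (ρ₀, ε₀, κ₀), TAG consts c₀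
  have hSw := blockWalkExpansion_domainLocal hS hκ₁₀ hlamS hρ₀ hκ₀ hμ hwin hrow
  have hRw := blockWalkExpansion_domainLocal hR hκ₁₀ hlamR hρ₀ hκ₀ hμ hwin hrow
  have hSdom : ∀ b, DomBy (toB6 (torusGeom K 0 0 0) 0 True) ((withOp L opS).dist X b) :=
    fun b => (withOp L opS).domBy_dist X b
  have hRdom : ∀ b, DomBy (toB6 (torusGeom K 0 0 0) 0 True) ((withOp L opR).dist X b) :=
    fun b => (withOp L opR).domBy_dist X b
  -- GEN 4's glue with its witnesses kept: ρ := ρ₀ − 2μ, ε := ε₀ − 2μ, ρs := ρ₀ − μ, κs := κ₀ − μ, κ := κ₀ − 2μ;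
  -- product window ρ′ := ρ₀ − 3μ, ε′ := ε₀ − 3μ, κ′ := κ₀ − 2μ
  have hone := blockWalkExpansion_one (d := d) (N' := N') (E := E) c₀ cubn X R ((ρ₀ - μ) + μ - ((ρ₀ - 2 * μ) - (ε₀ - 2 * μ)))
    ((ρ₀ - 2 * μ) - (ε₀ - 2 * μ))
  have hinv := blockWalkExpansion_inv_pencil (A := fun (_ : TPt d N' → ℂ) (_ : E) => (1 : Matrix n n ℂ))
    (t := (-1 : ℂ)) (τ := 1) (ρ := ρ₀ - 2 * μ) (ε := ε₀ - 2 * μ) (ρs := ρ₀ - μ) (κs := κ₀ - μ) (κ := κ₀ - 2 * μ)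
    hone hRw (fun _ a b => le_rfl) hRdom (fun σ₀ _ u _ => Matrix.one_mul _) hrow hrow hμ hμ hcμ hcμ
    (by linarith) (by linarith) (by linarith) (by linarith) (by linarith) (by linarith) (by linarith) zero_le_one (by positivity)
    (by linarith) (by linarith) (by linarith) (by linarith) (by linarith) (by linarith) zero_le_one (by simp) hq
  have hq1 : 0 < 1 - cμ * (cμ * 1 *
      (1 * ((lamR * Real.exp (c₀.κ₁ * mJ) * Real.exp (2 * ρ₀ * r)) * Real.exp (μ * r) * (nD * cμ))) * cμ) * cμ := by linarith
  have hCdom : ∀ ω : List (Unit × L.B) × Unit, DomBy (toB6 (torusGeom K 0 0 0) 0 True)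
      (chainDist (g := toB6 (torusGeom K 0 0 0) 0 True)
        (fun i : Unit × L.B => infConv (g := toB6 (torusGeom K 0 0 0) 0 True) (tdist1 K)
          ((withOp L opR).dist X i.2)) (tdist1 K) ω.1) :=
    fun ω => domBy_chain (DC := fun _ : Unit => tdist1 K) (fun _ a b => le_rfl) hRdom ω
  have hmul := blockWalkExpansion_mul (ρ := ρ₀ - 3 * μ) (ε := ε₀ - 3 * μ) (κ := κ₀ - 2 * μ) hSw hinv hSdom hCdom hrow hrow
    (by linarith) (by linarith) hμ (by linarith) (by linarith) (by linarith) (by linarith) (by positivity) (by positivity)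
    (by linarith) le_rfl (by linarith) hcμ
  -- the decoration and its tube letter
  have hdom : ∀ b, (L.dom b).Nonempty := fun b => ⟨L.anchor b, hS.hanchor b⟩
  refine ⟨_, _, _, _, _, decG J', blockWalkExpansion_decorate hmul hκ₁₀ hκ₁ (decG J') (fun ω hω => ?_) (P₀ := P)
    (P₁ := P / r₀) (fun ω u _ y y' _ => ?_) hshift, fun u hu => ?_, fun ω => domBy_infConv_torus (hSdom ω.1) (hCdom ω.2)⟩
  · -- dec ω ≠ ∅ ⟹ a tagged term: ω is σ-carrying in the glued family
    rcases decG_nonempty J' ω hω with h0 | ⟨i, hi, hJi⟩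
    · exact Or.inl (hJ'J ω.1 h0)
    · exact Or.inr (Or.inr ⟨i, hi, Or.inr (hJ'J i.2 hJi)⟩)
  · -- the tube letter: #dec ω ≤ P(1 + D_ω∕r₀) = P + (P∕r₀)·D_ω
    have h := card_params_le (L := L) (X := X) hdom hr₀ hRD hS.hdiam cellOf hpack J' hJ' ω.1 ω.2.1 y y' (decG J' ω)
      (fun δ hδ => mem_decG J' ω.1 ω.2.1 ω.2.2 hδ)
    have e : (P : ℝ) * (1 + Dch L X ω.1 ω.2.1 y y' / r₀) = P + P / r₀ * Dch L X ω.1 ω.2.1 y y' := by ring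
    rw [e] at h
    exact h
  · exact kernel_decorate_one hmul hκ₁₀ (decG J') u hu

end Summit.QuantumFields.BalabanUV.Gaps.D4WalkBlockOneScaleDecorated

end
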